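import Literature.AlgebraicGeometry.Modules.SerreTwistSegreClass
import Literature.AlgebraicGeometry.Motives.ProjBaseChangeAny
import Literature.AlgebraicGeometry.RelativeSpec.SymmetricPowerBaseChange
import Literature.AlgebraicGeometry.ModuliOfAbelianVarieties.SiegelHilbertBaseWithSections
import Mathlib.AlgebraicGeometry.Morphisms.Immersion
import HarnessLib

/-!
# Immersing a subscheme of a fibre power `(Z′)ⁿ_{T′}`, `Z′ ⊂ 𝐏(J; T′)`, into a projective space over a ring

Layer `Literature/AlgebraicGeometry/Morphisms`, namespace `Literature.AlgebraicGeometry.Morphisms`.  THEOREMS ONLY (no definition, no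
named fact, no instance, no notation, no `sorry`).  Cell `hodgecm-mathlib` (D-0151 ∕ FLOOR 0), programme P1, sub-line F-13 (`stub_PL`), inner
target P4 (`stub_PLofHilbertBase`) — the GENERIC half of [MumfordFogartyKirwan1994] Ch. 7 §2 Prop. 7.4 (p. 135): «`H_{g,d,n}` is
quasi-projective over `Spec ℤ` … via `H ⊂ (𝐏_m)^{n} × Hilb` and Grothendieck's embedding of `Hilb` in a Grassmannian», i.e. a scheme
immersed in the fibre power `(Z′)ⁿ_{T′}` of a closed subscheme `Z′ ⊂ 𝐏(J; T′)` over a base `T′` itself immersed in `𝐏ᴹ_L` is immersed in ONE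
projective space `𝐏ᶜ_L` (Segre), with the twisting class the product of the coordinate classes ([Hartshorne1977] II Ex. 5.11, Prop. 5.12).
Count-neutral capital: HC_CM is proved only modulo the 7 printed citations until rung 0 closes — nothing here bears on a summit statement.

* §1 `isPullback_projMap_terminal`, `exists_lift_projMap` — `𝐏ʳ_L = 𝐏ʳ_K × Spec L` for `Spec K` terminal (★
  `ProjBaseChangeRing.isPullback_projMap'`), lifts `X → 𝐏ʳ_L` of maps `X → 𝐏ʳ_K` with the same twisting class (★
  `detClass_serreTwist_comp_projMap`).
* §2 `exists_isPullback_projectiveSpaceFst_toSpec` — `𝐏(J; T) = 𝐏ᵐ_L ×_{Spec L} T` for an `L`-scheme `T` (cartesian square + class clause);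
  `exists_isImmersion_lift_baseChange` — the base change `Y × Spec L → 𝐏ᴹ_L` of an immersion `Y → 𝐏ᴹ_ℤ` is an immersion with the same class.
* §3 **`exists_isImmersion_PP_of_powOver`** — the Segre immersion of `H ⊂ (Z′)ⁿ⁺¹_{T′}` with its class (★ `SerreTwist.exists_segre_powOver`,
  ★ `detClass_serreTwist_segre_lift`, ★ `RelativeSpec.isPullback_powOver_lift`, ★ `isClosedImmersion_powOver_map_of_comp`).

## References
* [MumfordFogartyKirwan1994] D. Mumford, J. Fogarty, F. Kirwan, *Geometric Invariant Theory*, 3rd ed. (1994), Ch. 7 §2 Prop. 7.4 (p. 135).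
* [Hartshorne1977] R. Hartshorne, *Algebraic Geometry* (1977), II Ex. 5.11 (p. 125), II Prop. 5.12 (b), (c) (p. 117).
* [StacksProject] The Stacks Project, Tag 01WC (projective space over a scheme).
-/

noncomputable section

-- `Morphisms.projectiveSpace ι S` is a `def` over Mathlib's `pullback`; `TopCat.Presheaf` is not reducible.
set_option backward.isDefEq.respectTransparency false

open CategoryTheory CategoryTheory.Limits AlgebraicGeometry
open Literature.AlgebraicGeometry.Modules Literature.AlgebraicGeometry.Modules.SerreTwist
open Literature.AlgebraicGeometry.Motives Literature.AlgebraicGeometry.Morphisms.ProjCech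
open Literature.AlgebraicGeometry.RelativeSpec Literature.AlgebraicGeometry.ModuliOfAbelianVarieties
open Literature.AlgebraicGeometry.Motives.Segre (segre isClosedImmersion_segre)

namespace Literature.AlgebraicGeometry.Morphisms

/-! ## §1 `𝐏ʳ_L = 𝐏ʳ_K × Spec L` and lifts along it -/

section LiftAlongProjMap

universe u

variable (K L : Type u) [CommRing K] [CommRing L] [Algebra K L] {r : ℕ}

/-- **`𝐏ʳ_L = 𝐏ʳ_K × Spec L` (absolute product) when `Spec K` is terminal** (e.g. `K = ℤ`): the square
`(𝐏ʳ_L → 𝐏ʳ_K, 𝐏ʳ_L → Spec L)` against the maps to the terminal scheme is cartesian (★ `ProjBaseChangeRing.isPullback_projMap'`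
pasted with the trivially cartesian square of the isomorphism `Spec K → ⊤`). [cite: Hartshorne1977, II Ex. 5.11 (p. 125)]
[cite: StacksProject, Tag 01WC] -/
theorem isPullback_projMap_terminal (hK : IsTerminal (Spec (.of K))) :
    letI := MvPolynomial.gradedAlgebra (σ := Fin (r + 1)) (R := K)
    letI := MvPolynomial.gradedAlgebra (σ := Fin (r + 1)) (R := L)
    IsPullback (Proj.map (ProjBaseChangeRing.mapGraded K L (Fin (r + 1)))
        (ProjBaseChangeRing.irrelevant_le_map K L (Fin (r + 1))) : PP L r ⟶ PP K r)
      (toSpec L r) (terminal.from (PP K r)) (terminal.from (Spec (.of L))) := by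
  letI := MvPolynomial.gradedAlgebra (σ := Fin (r + 1)) (R := K)
  letI := MvPolynomial.gradedAlgebra (σ := Fin (r + 1)) (R := L)
  haveI : IsIso (terminal.from (Spec (.of K))) := by
    rw [show terminal.from (Spec (.of K)) = (hK.uniqueUpToIso terminalIsTerminal).hom from terminal.hom_ext _ _]
    infer_instance
  have F : IsPullback (𝟙 (PP K r)) (toSpec K r) (terminal.from (PP K r)) (terminal.from (Spec (.of K))) :=
    IsPullback.of_horiz_isIso ⟨terminal.hom_ext _ _⟩
  have h := (ProjBaseChangeRing.isPullback_projMap' K L (n := r)).paste_horiz F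
  rwa [Category.comp_id, terminal.comp_from] at h

/-- **Lifting an `L`-scheme's map to `𝐏ʳ_K` into `𝐏ʳ_L`** (`Spec K` terminal): for `x : X → 𝐏ʳ_K` and the structure map
`h : X → Spec L` there is `x̂ : X → 𝐏ʳ_L` over `Spec L` with `x̂ ≫ (𝐏ʳ_L → 𝐏ʳ_K) = x`, and the class of the Serre twist along `x̂` is
the class along `x` (★ `detClass_serreTwist_comp_projMap`: `𝒪_{𝐏ʳ_L}(1)` is the pull-back of `𝒪_{𝐏ʳ_K}(1)`).
[cite: Hartshorne1977, II Prop. 5.12 (c)] [cite: StacksProject, Tag 01WC] -/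
theorem exists_lift_projMap (hK : IsTerminal (Spec (.of K))) {X : Scheme.{u}} (x : X ⟶ PP K r) (h : X ⟶ Spec (.of L)) :
    letI := MvPolynomial.gradedAlgebra (σ := Fin (r + 1)) (R := K)
    letI := MvPolynomial.gradedAlgebra (σ := Fin (r + 1)) (R := L)
    ∃ x' : X ⟶ PP L r, x' ≫ toSpec L r = h ∧
      x' ≫ Proj.map (ProjBaseChangeRing.mapGraded K L (Fin (r + 1))) (ProjBaseChangeRing.irrelevant_le_map K L (Fin (r + 1))) = x ∧
      ∀ t : ℕ, detClass (isFiniteLocallyFree_serreTwist x' t) = detClass (isFiniteLocallyFree_serreTwist x t) := by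
  letI := MvPolynomial.gradedAlgebra (σ := Fin (r + 1)) (R := K)
  letI := MvPolynomial.gradedAlgebra (σ := Fin (r + 1)) (R := L)
  have sq := isPullback_projMap_terminal K L hK (r := r)
  refine ⟨sq.lift x h (terminal.hom_ext _ _), sq.lift_snd _ _ _, sq.lift_fst _ _ _, fun t => ?_⟩
  conv_rhs => rw [← sq.lift_fst x h (terminal.hom_ext _ _)]
  exact (detClass_serreTwist_comp_projMap K L _ t).symm

end LiftAlongProjMap

/-! ## §2 `𝐏(J; T) = 𝐏ᵐ_L ×_{Spec L} T`; base change of an immersion `Y → 𝐏ᴹ_ℤ` -/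

section ProjectiveSpaceOverRing

variable (L : Type) [CommRing L] (J : Type) {T : Scheme.{0}} (h : T ⟶ Spec (.of L))

/-- **`𝐏(J; T) = 𝐏ᵐ_L ×_{Spec L} T` for an `L`-scheme `T`** (`m = #J`): there is `b_T : 𝐏(J; T) → 𝐏ᵐ_L` with
`(b_T, pr₁ ; 𝐏ᵐ_L → Spec L, h)` cartesian and, for every `y : X → 𝐏(J; T)`, the class of the Serre twist along `y ≫ b_T` equal to the
class along `y ≫ pr₂ : X → 𝐏ᵐ_ℤ` — cut from `𝐏(J; T) = T × 𝐏ᵐ_ℤ` (its definition) and `𝐏ᵐ_L = 𝐏ᵐ_ℤ × Spec L`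
(`isPullback_projMap_terminal`) by Mathlib `IsPullback.of_right`; the classes agree by ★ `detClass_serreTwist_comp_projMap`
(`b_T ≫ (𝐏ᵐ_L → 𝐏ᵐ_ℤ) = pr₂`). [cite: Hartshorne1977, II Ex. 5.11 (p. 125)] [cite: Hartshorne1977, II Prop. 5.12 (c)]
[cite: StacksProject, Tag 01WC] -/
theorem exists_isPullback_projectiveSpaceFst_toSpec :
    ∃ bT : Morphisms.projectiveSpace J T ⟶ PP L (Nat.card J),
      IsPullback bT (Morphisms.projectiveSpaceFst J T) (toSpec L (Nat.card J)) h ∧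
      ∀ ⦃X : Scheme.{0}⦄ (y : X ⟶ Morphisms.projectiveSpace J T) (t : ℕ),
        detClass (isFiniteLocallyFree_serreTwist (y ≫ bT) t) =
          detClass (isFiniteLocallyFree_serreTwist
            (y ≫ pullback.snd (terminal.from T) (terminal.from (projectiveSpaceInt J))) t) := by
  letI : Algebra intU.{0} L := ULift.algebra' ℤ L
  letI := MvPolynomial.gradedAlgebra (σ := Fin (Nat.card J + 1)) (R := intU.{0})
  letI := MvPolynomial.gradedAlgebra (σ := Fin (Nat.card J + 1)) (R := L)
  have B := isPullback_projMap_terminal intU.{0} L specULiftZIsTerminal (r := Nat.card J)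
  have hw : (pullback.snd (terminal.from T) (terminal.from (projectiveSpaceInt J)) :
        Morphisms.projectiveSpace J T ⟶ PP intU.{0} (Nat.card J)) ≫ terminal.from (PP intU.{0} (Nat.card J)) =
      (Morphisms.projectiveSpaceFst J T ≫ h) ≫ terminal.from (Spec (.of L)) := terminal.hom_ext _ _
  refine ⟨B.lift _ _ hw, IsPullback.of_right ?_ (B.lift_snd _ _ hw) B, fun X y t => ?_⟩
  · rw [B.lift_fst _ _ hw, terminal.comp_from]
    exact (IsPullback.of_hasPullback (terminal.from T) (terminal.from (projectiveSpaceInt J))).flip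
  · rw [← detClass_serreTwist_comp_projMap intU.{0} L (y ≫ B.lift _ _ hw) t]
    simp only [Category.assoc, B.lift_fst _ _ hw]

/-- **The base change `Y × Spec L → 𝐏ᴹ_L` of an immersion `x : Y → 𝐏ᴹ_ℤ` is an immersion over `Spec L` with the same twisting
class**: the lift `ψ` of `(pr₁ ≫ x, pr₂)` into `𝐏ᴹ_L = 𝐏ᴹ_ℤ × Spec L` (`isPullback_projMap_terminal`) sits in the cartesian square
`(ψ, pr₁ ; 𝐏ᴹ_L → 𝐏ᴹ_ℤ, x)` (Mathlib `IsPullback.of_right`), so it is an immersion (immersions are stable under base change), and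
`[ψ^*𝒪(-t)] = [(pr₁ ≫ x)^*𝒪(-t)]` (★ `detClass_serreTwist_comp_projMap`). [cite: Hartshorne1977, II Prop. 5.12 (c)]
[cite: StacksProject, Tag 01WC] -/
theorem exists_isImmersion_lift_baseChange {Y : Scheme.{0}} {M : ℕ} (x : Y ⟶ PP intU.{0} M) [IsImmersion x] :
    ∃ ψ : pullback (terminal.from Y) (terminal.from (Spec (.of L))) ⟶ PP L M, IsImmersion ψ ∧
      ψ ≫ toSpec L M = pullback.snd (terminal.from Y) (terminal.from (Spec (.of L))) ∧
      ∀ t : ℕ, detClass (isFiniteLocallyFree_serreTwist ψ t) =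
        detClass (isFiniteLocallyFree_serreTwist (pullback.fst (terminal.from Y) (terminal.from (Spec (.of L))) ≫ x) t) := by
  letI : Algebra intU.{0} L := ULift.algebra' ℤ L
  letI := MvPolynomial.gradedAlgebra (σ := Fin (M + 1)) (R := intU.{0})
  letI := MvPolynomial.gradedAlgebra (σ := Fin (M + 1)) (R := L)
  have B := isPullback_projMap_terminal intU.{0} L specULiftZIsTerminal (r := M)
  have hw : (pullback.fst (terminal.from Y) (terminal.from (Spec (.of L))) ≫ x) ≫ terminal.from (PP intU.{0} M) =
      pullback.snd (terminal.from Y) (terminal.from (Spec (.of L))) ≫ terminal.from (Spec (.of L)) := terminal.hom_ext _ _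
  have sq : IsPullback (B.lift _ _ hw) (pullback.fst (terminal.from Y) (terminal.from (Spec (.of L))))
      (Proj.map (ProjBaseChangeRing.mapGraded intU.{0} L (Fin (M + 1))) (ProjBaseChangeRing.irrelevant_le_map intU.{0} L (Fin (M + 1))))
      x := by
    refine IsPullback.of_right ?_ (B.lift_fst _ _ hw) B.flip
    rw [B.lift_snd _ _ hw, terminal.comp_from]
    exact (IsPullback.of_hasPullback (terminal.from Y) (terminal.from (Spec (.of L)))).flip
  refine ⟨B.lift _ _ hw, MorphismProperty.of_isPullback (P := @IsImmersion) sq.flip inferInstance, B.lift_snd _ _ hw,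
    fun t => ?_⟩
  rw [← detClass_serreTwist_comp_projMap intU.{0} L (B.lift _ _ hw) t]
  simp only [B.lift_fst _ _ hw]

end ProjectiveSpaceOverRing

/-! ## §3 The Segre immersion of `H ⊂ (Z′)ⁿ⁺¹_{T′}` and its class -/

section PowOverEmbedding

/-- **An immersed subscheme of `(Z′)ⁿ⁺¹_{T′}`, `Z′ ⊂ 𝐏(J; T′)` closed, `T′` immersed in `𝐏ᴹ_L` over `Spec L`, is immersed in a
projective space over `L` by a Segre product whose twisting class is the product of the coordinate classes** — the embedding
`H ⊂ (𝐏_m)^{n+1} × 𝐏ᴹ ⊂ 𝐏ᶜ` of [MumfordFogartyKirwan1994] Prop. 7.4 (p. 135), in the tree's currency: `jH ≫ κ` (★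
`isClosedImmersion_powOver_map_of_comp`: `(Z′)ⁿ⁺¹_{T′} ↪ 𝐏(J; T′)ⁿ⁺¹_{T′}`), the base-change square `W`
(`𝐏(J; T′)ⁿ⁺¹_{T′} = (𝐏ᵐ_L)ⁿ⁺¹_{Spec L} ×_{Spec L} T′`), `pullback.map 𝟙 ψ₁`, `pullback.map s 𝟙` for the iterated Segre embedding `s` of
★ `SerreTwist.exists_segre_powOver`, and ★ `segre`; classes by ★ `detClass_serreTwist_segre_lift` and the class clause of `s`.
[cite: MumfordFogartyKirwan1994, Ch. 7 §2 Proposition 7.4 (p. 135)] [cite: Hartshorne1977, II Ex. 5.11 (p. 125)] -/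
theorem exists_isImmersion_PP_of_powOver (L : Type) [CommRing L] {J : Type} {T' Z' : Scheme.{0}} (f₁ : T' ⟶ Spec (.of L))
    (iH' : Z' ⟶ Morphisms.projectiveSpace J T') [IsClosedImmersion iH']
    (bT : Morphisms.projectiveSpace J T' ⟶ PP L (Nat.card J))
    (sqT : IsPullback bT (Morphisms.projectiveSpaceFst J T') (toSpec L (Nat.card J)) f₁)
    (hbT : ∀ ⦃X : Scheme.{0}⦄ (y : X ⟶ Morphisms.projectiveSpace J T') (t : ℕ),
      detClass (isFiniteLocallyFree_serreTwist (y ≫ bT) t) =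
        detClass (isFiniteLocallyFree_serreTwist (y ≫ pullback.snd (terminal.from T') (terminal.from (projectiveSpaceInt J))) t))
    (n₀ : ℕ)
    (W : IsPullback
      (WidePullback.lift (objs := fun _ : Fin (n₀ + 1) => PP L (Nat.card J)) (arrows := fun _ => toSpec L (Nat.card J))
        (powOver.base (Morphisms.projectiveSpaceFst J T') (n₀ + 1) ≫ f₁)
        (fun k => powOver.proj (Morphisms.projectiveSpaceFst J T') (n₀ + 1) k ≫ bT)
        (fun k => by rw [Category.assoc, sqT.w, ← Category.assoc, WidePullback.π_arrow]))
      (powOver.base (Morphisms.projectiveSpaceFst J T') (n₀ + 1)) (powOver.base (toSpec L (Nat.card J)) (n₀ + 1)) f₁)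
    {M : ℕ} (ψ₁ : T' ⟶ PP L M) [IsImmersion ψ₁] (hψ₁ : ψ₁ ≫ toSpec L M = f₁)
    {H : Scheme.{0}} (jH : H ⟶ powOver (iH' ≫ Morphisms.projectiveSpaceFst J T') (n₀ + 1)) [IsImmersion jH] :
    ∃ (c : ℕ) (ιH : H ⟶ PP L c), IsImmersion ιH ∧
      ιH ≫ toSpec L c = jH ≫ powOver.base (iH' ≫ Morphisms.projectiveSpaceFst J T') (n₀ + 1) ≫ f₁ ∧
      ∀ t : ℕ, detClass (isFiniteLocallyFree_serreTwist ιH t) =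
        (∏ k, detClass (isFiniteLocallyFree_serreTwist
          ((jH ≫ powOver.proj (iH' ≫ Morphisms.projectiveSpaceFst J T') (n₀ + 1) k ≫ iH') ≫
            pullback.snd (terminal.from T') (terminal.from (projectiveSpaceInt J))) t)) *
        detClass (isFiniteLocallyFree_serreTwist
          (jH ≫ powOver.base (iH' ≫ Morphisms.projectiveSpaceFst J T') (n₀ + 1) ≫ ψ₁) t) := by
  obtain ⟨R, s, hs, hsS, hscl⟩ := SerreTwist.exists_segre_powOver L (Nat.card J) n₀
  have hR : (R + 1) * (M + 1) = R * M + R + M + 1 := by ring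
  let e : Fin (R + 1) × Fin (M + 1) ≃ Fin (R * M + R + M + 1) := finProdFinEquiv.trans (finCongr hR)
  set κ := WidePullback.lift (objs := fun _ : Fin (n₀ + 1) => Morphisms.projectiveSpace J T') (arrows := fun _ => Morphisms.projectiveSpaceFst J T')
    (powOver.base (iH' ≫ Morphisms.projectiveSpaceFst J T') (n₀ + 1)) (fun k => powOver.proj (iH' ≫ Morphisms.projectiveSpaceFst J T') (n₀ + 1) k ≫ iH')
    (fun k => by rw [Category.assoc, WidePullback.π_arrow]) with hκ
  haveI : IsClosedImmersion κ := isClosedImmersion_powOver_map_of_comp iH' (Morphisms.projectiveSpaceFst J T') (n₀ + 1)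
  set cmp := WidePullback.lift (objs := fun _ : Fin (n₀ + 1) => PP L (Nat.card J)) (arrows := fun _ => toSpec L (Nat.card J))
        (powOver.base (Morphisms.projectiveSpaceFst J T') (n₀ + 1) ≫ f₁) (fun k => powOver.proj (Morphisms.projectiveSpaceFst J T') (n₀ + 1) k ≫ bT)
        (fun k => by rw [Category.assoc, sqT.w, ← Category.assoc, WidePullback.π_arrow]) with hcmp
  set Λ := jH ≫ κ ≫ cmp with hΛ
  set v := jH ≫ powOver.base (iH' ≫ Morphisms.projectiveSpaceFst J T') (n₀ + 1) with hv
  have hκb : κ ≫ powOver.base (Morphisms.projectiveSpaceFst J T') (n₀ + 1) = powOver.base (iH' ≫ Morphisms.projectiveSpaceFst J T') (n₀ + 1) :=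
    WidePullback.lift_base _ _ _ _
  have hΛb : Λ ≫ powOver.base (toSpec L (Nat.card J)) (n₀ + 1) = v ≫ f₁ := by
    simp only [hΛ, hv, Category.assoc]
    rw [WidePullback.lift_base, ← Category.assoc κ, hκb]
  set φ := Λ ≫ s with hφ
  set ψ := jH ≫ powOver.base (iH' ≫ Morphisms.projectiveSpaceFst J T') (n₀ + 1) ≫ ψ₁ with hψ
  have w : φ ≫ Segre.toSpec (Fin (R + 1)) L = ψ ≫ Segre.toSpec (Fin (M + 1)) L := by
    change (Λ ≫ s) ≫ toSpec L R = (jH ≫ powOver.base (iH' ≫ Morphisms.projectiveSpaceFst J T') (n₀ + 1) ≫ ψ₁) ≫ toSpec L M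
    rw [Category.assoc, hsS, hΛb, hv]
    simp only [Category.assoc, hψ₁]
  -- the three factors of `(φ, ψ)`
  have e₁ : powOver.base (toSpec L (Nat.card J)) (n₀ + 1) = 𝟙 _ ≫ powOver.base (toSpec L (Nat.card J)) (n₀ + 1) :=
    (Category.id_comp _).symm
  have e₂ : f₁ = ψ₁ ≫ toSpec L M := hψ₁.symm
  have e₃ : powOver.base (toSpec L (Nat.card J)) (n₀ + 1) = s ≫ Segre.toSpec (Fin (R + 1)) L := hsS.symm
  have e₄ : toSpec L M = 𝟙 _ ≫ Segre.toSpec (Fin (M + 1)) L := (Category.id_comp _).symm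
  haveI i₂ := MorphismProperty.pullbackMap (P := @IsImmersion) (f := powOver.base (toSpec L (Nat.card J)) (n₀ + 1)) (g := f₁)
    (inferInstance : IsImmersion (𝟙 _)) (inferInstance : IsImmersion ψ₁) e₁ e₂
  haveI i₃ := MorphismProperty.pullbackMap (P := @IsImmersion) (f := powOver.base (toSpec L (Nat.card J)) (n₀ + 1))
    (g := toSpec L M) (show IsImmersion s from inferInstance) (inferInstance : IsImmersion (𝟙 _)) e₃ e₄
  have h1 : pullback.lift Λ v hΛb = (jH ≫ κ) ≫ W.isoPullback.hom := by
    apply pullback.hom_ext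
    · rw [pullback.lift_fst, Category.assoc, IsPullback.isoPullback_hom_fst, hΛ, Category.assoc]
    · rw [pullback.lift_snd, Category.assoc, IsPullback.isoPullback_hom_snd, hv, Category.assoc, hκb]
  have h2 : pullback.lift φ ψ w = pullback.lift Λ v hΛb ≫
      pullback.map _ _ _ _ (𝟙 _) ψ₁ (𝟙 _) ((Category.comp_id _).trans e₁) ((Category.comp_id _).trans e₂) ≫
      pullback.map _ _ _ _ s (𝟙 _) (𝟙 _) ((Category.comp_id _).trans e₃) ((Category.comp_id _).trans e₄) := by
    apply pullback.hom_ext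
    · simp only [Category.assoc, pullback.lift_fst, pullback.lift_fst_assoc, Category.id_comp, hφ]
    · simp only [Category.assoc, pullback.lift_snd, pullback.lift_snd_assoc, Category.comp_id, hψ, hv]
  haveI : IsImmersion (jH ≫ κ) := inferInstance
  haveI : IsImmersion (pullback.lift Λ v hΛb) := by rw [h1]; infer_instance
  haveI := isClosedImmersion_segre L e
  refine ⟨R * M + R + M, pullback.lift φ ψ w ≫ segre L e, ?_, ?_, fun t => ?_⟩
  · rw [h2]; infer_instance
  · change (pullback.lift φ ψ w ≫ segre L e) ≫ Segre.toSpec (Fin (R * M + R + M + 1)) L = _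
    rw [segre_lift_toSpec]
    change (Λ ≫ s) ≫ toSpec L R = _
    rw [Category.assoc, hsS, hΛb, hv, Category.assoc]
  · rw [detClass_serreTwist_segre_lift e φ ψ w t]
    congr 1
    change detClass (isFiniteLocallyFree_serreTwist (Λ ≫ s) t) = _
    rw [hscl H Λ t]
    refine Finset.prod_congr rfl fun k _ => ?_
    have hk : Λ ≫ powOver.proj (toSpec L (Nat.card J)) (n₀ + 1) k =
        (jH ≫ powOver.proj (iH' ≫ Morphisms.projectiveSpaceFst J T') (n₀ + 1) k ≫ iH') ≫ bT := by
      simp only [hΛ, Category.assoc]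
      rw [WidePullback.lift_π, ← Category.assoc κ, WidePullback.lift_π, Category.assoc]
    rw [hk, hbT]

end PowOverEmbedding

end Literature.AlgebraicGeometry.Morphisms

end
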